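/-
Copyright (c) 2026 the pub-hodgecm-mathlib formalisation cell (harness21).  Prover seat hodgecm-mathlib-F0P3-p01 (g32), Track A «(D-RAM) FOUR-FRAME», unit U2H, census leaf
(ρ2b′-X) — T5b «TORIC LEVEL CENSUS, type RamK»: THE TOP HALF OF THE DIAGONAL (sheet (D3)) — generic count in index letters, and the RamK index form.  2026-09-04.
-/
import Summits.HodgeConjecture.HodgeConjecture.Theorems.F0P3cDyRamToricLevelCensusUnrTopPrep  -- ★ (LH4-p08 (g4)): `dep_top_iff`, `v_one_add_twist_eq_of_top`, approximate translation, `ncard_levelSetDep_eq_ncard_image_mk`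
import Literature.NumberTheory.LocalFields.QuadraticOrderNormDepthIndexRamK                   -- ★ p857459 (this seat): `[U_M : B_c] = idxRK q d c` (two-field RamK frame)
import HarnessLib

/-!
# (ρ2b′-X) T5b — the depth-refined census on the TOP HALF OF THE DIAGONAL: `#levelSetDep(j,a;μ) = [B_(j+a−m) : 𝒪_jˣ]·bit` (generic), and its type-RamK index form

`Summits/HodgeConjecture/HodgeConjecture/Theorems/F0P3cDyRamToricLevelCensusRamKTop.lean`, namespace `Summit.HodgeConjecture.HodgeConjecture.Cruxes.H413.F0P3cDyRamToricLevelCensusRamK`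
(fourth file of the T5b HEAD namespace).  PROOF FILE of a SUPPORT organ (`--supports stmt-HodgeConjecture-24833 --as helper`; no stub credit claimed; hodgecm-mathlib-F0P3-p01
(g32) for the (ρ2b′-X) payer LH4-p14's lineage, dealer LH4-plan (g12) WORD #16).  THEOREMS ONLY (no `def`, no instance, no notation, no sorry).
THE ROW (D3) of the sheet: on the diagonal `j + m = jλ + a` with `2a ≥ m + 1` (`|μ| = exp(−m)`, `|μ − ρμ| = exp(−jλ)`), LH4-p08 (g4)'s ★ `dep_top_iff` turns the depth clause of
`Λ = x₀𝒪_j ∈ levelSet(j,a)` into `|1 + (η∕κ)·t(x₀)| ≤ exp(−s₀)`, `s₀ = j + a − m`, `η = ρh∕h`, `κ = ρμ∕μ`, and ★ `v_one_add_twist_eq_of_top` makes the level clause automatic.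
§1 (GENERIC, `M∕E`-unramified letters, no third field, no translator, explicit parity `v_h + 2k₀ + j = a`): **`ncard_levelSetDep_top_eq_ite`** —
`#levelSetDep(j,a;μ) = [B_(s₀) : 𝒪_jˣ]` if SOME unit `ω₁` has `|1 + (η∕κ)t(ω₁)| ≤ exp(−s₀)` (then the passing generators are `ϖE^k₀·ω₁·B_(s₀)`, ★ approximate translation), else
`0`; **`top_bit_iff_exists_norm_class`** rewrites the bit as the norm-class membership `(α − ρα)·h·ρμ ∈ ϖEᶻ·𝒪_(s₀)ˣ·N_Θ(U_M)` (the sheet's (D3)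
`z ∈ N·𝒪_{c′}ˣ`, κ-corrected); this serves every descent type with `M∕E` unramified (LH4-p08 (g4)'s type-U ★ `ncard_levelSetDep_top_hyper` is the case `[U : B_c] = q^((c+1−d)∕2)`).  §2 (TYPE RamK,
two-field frame of ★ p857459): **`ncard_levelSetDep_top_mul_eq_of_ramK`** — `#levelSetDep(j,a;μ)·idxRK(q,d,s₀) = |G_j|·bit` with `|G_j| = (q+1)q^(j−1)` and `idxRK` spelled as
★ p857459's if-then-else (the `s₀ = 0` branch is dead since `s₀ ≥ 1`).  The bit is left as the honest token `∃ ω₁ …` (its evaluation per cell is the payer's diagonal rule).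
HONEST LABEL: HC_CM is proved only modulo the 7 printed citations (2 remaining named inputs: hLiu418 = stmt-HodgeConjecture-24832, h413 = stmt-HodgeConjecture-24833) until rung 0
closes; this leaf is unconditional local algebra and count-neutral.

## References
* [Jacobowitz1962] R. Jacobowitz, *Hermitian forms over local fields*, Amer. J. Math. 84 (1962): §4 (duals, modular lattices).
* [Flicker1998UnitaryFL] Y. Flicker, Prop. 7 p. 84 (torus-orbit census on the tree).
* [Serre1979] J.-P. Serre, *Local Fields*, GTM 67 (1979): Ch. V §1, §3.
* [Kottwitz1986BaseChangeUnits] R. E. Kottwitz, *Base change for unit elements of Hecke algebras*, Compositio Math. 60 (1986): §1 pp. 240–241 (the depth ∕ tube condition).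
-/

set_option autoImplicit false

namespace Summit.HodgeConjecture.HodgeConjecture.Cruxes.H413.F0P3cDyRamToricLevelCensusRamK

open WithZero
open scoped Pointwise Valued
open Literature.NumberTheory.LocalFields.QuadraticOrder
open Summit.HodgeConjecture.HodgeConjecture.Cruxes.H413.F0P3cDyRamToricCensusDefs
open Summit.HodgeConjecture.HodgeConjecture.Cruxes.H413.F0P3cDyRamToricLevelCensusUnr

variable {K : Type} [Field K] [Valued K ℤᵐ⁰] {ρ Θ : K →+* K} {α ϖE h : K}
variable {K' : Type} [Field K'] [Valued K' ℤᵐ⁰] {σ' : K' →+* K'} {α' π' : K'}   -- the third field `K' ≅ K♮ = Fix Θ` (§2 only)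

/-! ## §1 The top half of the diagonal, generic: `#levelSetDep = [B_(s₀) : 𝒪_jˣ]·bit` -/

open scoped Classical in
/-- **(D3) GENERIC TOP COUNT**: `M∕E` unramified letters, parity `v_h + 2k₀ + j = a`, diagonal `j + m = jλ + a`, top half `m + 1 ≤ 2a`, `1 ≤ a ≤ j`, `a ≤ m`; with `H = 𝒪_jˣ` and
`B = B_(j+a−m)`: `#levelSetDep(j,a;μ) = [B : H]` if some unit `ω₁` has `|1 + (ρh∕h)∕(ρμ∕μ)·t(ω₁)| ≤ exp(−(j+a−m))`, else `0`. [cite: Jacobowitz1962, §4]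
[cite: Kottwitz1986BaseChangeUnits, §1 pp. 240–241] [cite: Serre1979, Ch. V §3] -/
theorem ncard_levelSetDep_top_eq_ite (hρρ : ∀ x, ρ (ρ x) = x) (hvρ : ∀ x, Valued.v (ρ x) = Valued.v x) (hΘΘ : ∀ x, Θ (Θ x) = x)
    (hΘρ : ∀ x, Θ (ρ x) = ρ (Θ x)) (hvΘ : ∀ x, Valued.v (Θ x) = Valued.v x) (hα1 : Valued.v α ≤ 1) (hα : Valued.v (α - ρ α) = 1)
    (hρϖE : ρ ϖE = ϖE) (hϖE : Valued.v ϖE = exp (-1 : ℤ)) (hh : h ≠ 0) {vh : ℤ} (hvh : Valued.v h = exp (-vh))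
    {μ : K} {m jl : ℕ} (hm : Valued.v μ = exp (-(m : ℤ))) (hjl : Valued.v (μ - ρ μ) = exp (-(jl : ℤ)))
    {j a : ℕ} (ha : 1 ≤ a) (haj : a ≤ j) (ham : a ≤ m) (hdiag : j + m = jl + a) (htop : m + 1 ≤ 2 * a) {k₀ : ℤ} (hk₀ : vh + 2 * k₀ + j = a)
    (H B : Subgroup Kˣ) (hH : ∀ u : Kˣ, u ∈ H ↔ Valued.v (u : K) = 1 ∧ Valued.v ((u : K) - ρ u) ≤ Valued.v (ϖE ^ j * (α - ρ α)))
    (hB : ∀ ω : Kˣ, ω ∈ B ↔ Valued.v (ω : K) = 1 ∧ Valued.v ((ω : K) * Θ ω - ρ ((ω : K) * Θ ω)) ≤ exp (-((j + a : ℕ) - (m : ℤ)))) :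
    (levelSetDep ρ Θ α ϖE h j a μ).ncard =
      if ∃ ω₁ : Kˣ, Valued.v (ω₁ : K) = 1 ∧
        Valued.v (1 + ρ h / h / (ρ μ / μ) * (ρ ((ω₁ : K) * Θ ω₁) / ((ω₁ : K) * Θ ω₁))) ≤ exp (-((j + a : ℕ) - (m : ℤ)))
      then H.relIndex B else 0 := by
  classical
  have hϖ0 : ϖE ≠ 0 := (v_varpi_zpow hϖE 0).1
  have hma : m < j + a := by omega
  have he : m < 2 * a := by omega
  -- (1) `levelSetDep` as generator classes (★ TopPrep §3)
  rw [ncard_levelSetDep_eq_ncard_image_mk hρρ hvρ hΘΘ hΘρ hvΘ hα1 hα hρϖE hϖE hh hm j a hH]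
  set g : Kˣ := Units.mk0 ϖE hϖ0 ^ k₀ with hg
  have hGen := setOf_levelGen_eq_smul_of_pos hρρ hΘρ hvΘ hα hϖE hρϖE hϖ0 hh hvh j ha hk₀
  have hgcoe : ∀ ω : Kˣ, ((g • ω : Kˣ) : K) = ϖE ^ k₀ * ω := fun ω => by
    rw [smul_eq_mul, Units.val_mul, hg, Units.val_zpow_eq_zpow_val, Units.val_mk0]
  -- (2) the passing generators are `g • {ω ∈ U_M : |1 + (η∕κ) t(ω)| ≤ exp(−s₀)}`
  have hPQ : {x₀ : Kˣ | (((Valued.v (h * ((x₀ : K) * Θ x₀) * (ϖE ^ j * (α - ρ α))) ≤ 1 ∧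
              Valued.v (h * ((x₀ : K) * Θ x₀) * (ϖE ^ j * (α - ρ α)) - ρ (h * ((x₀ : K) * Θ x₀) * (ϖE ^ j * (α - ρ α)))) ≤ Valued.v (ϖE ^ j * (α - ρ α))) ∧
            ¬ (Valued.v (h * ((x₀ : K) * Θ x₀) * (ϖE ^ j * (α - ρ α)) / ϖE) ≤ 1 ∧
                Valued.v (h * ((x₀ : K) * Θ x₀) * (ϖE ^ j * (α - ρ α)) / ϖE - ρ (h * ((x₀ : K) * Θ x₀) * (ϖE ^ j * (α - ρ α)) / ϖE)) ≤
                  Valued.v (ϖE ^ j * (α - ρ α)))) ∧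
          Valued.v (h * ((x₀ : K) * Θ x₀) * (ϖE ^ j * (α - ρ α))) = exp (-(a : ℤ))) ∧
        (a ≤ m ∧ (j + a ≤ m ∨
          Valued.v (μ / (h * ((x₀ : K) * Θ x₀) * (ϖE ^ j * (α - ρ α)) * ϖE ^ (m - a)) -
              ρ (μ / (h * ((x₀ : K) * Θ x₀) * (ϖE ^ j * (α - ρ α)) * ϖE ^ (m - a)))) ≤ exp (-((j + a : ℕ) - (m : ℤ)))))} =
      g • {ω : Kˣ | Valued.v (ω : K) = 1 ∧
        Valued.v (1 + ρ h / h / (ρ μ / μ) * (ρ ((ω : K) * Θ ω) / ((ω : K) * Θ ω))) ≤ exp (-((j + a : ℕ) - (m : ℤ)))} := by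
    ext x₀
    rw [Set.mem_smul_set_iff_inv_smul_mem, Set.mem_setOf_eq, Set.mem_setOf_eq]
    have hx : x₀ = g • (g⁻¹ • x₀) := (smul_inv_smul g x₀).symm
    have hxcoe : (x₀ : K) = ϖE ^ k₀ * ((g⁻¹ • x₀ : Kˣ) : K) := by
      conv_lhs => rw [hx]
      exact hgcoe _
    have htw : ρ ((x₀ : K) * Θ x₀) / ((x₀ : K) * Θ x₀) =
        ρ (((g⁻¹ • x₀ : Kˣ) : K) * Θ ((g⁻¹ • x₀ : Kˣ) : K)) / (((g⁻¹ • x₀ : Kˣ) : K) * Θ ((g⁻¹ • x₀ : Kˣ) : K)) := by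
      rw [hxcoe]; exact twist_varpi_zpow_mul hΘρ hρϖE hϖ0 _ _
    constructor
    · rintro ⟨hP, hQ⟩
      have hmem : x₀ ∈ g • {ω : Kˣ | Valued.v (ω : K) = 1 ∧
          Valued.v (1 + ρ h / h * (ρ ((ω : K) * Θ ω) / ((ω : K) * Θ ω))) = exp ((a : ℤ) - j)} := by rw [← hGen]; exact hP
      rw [Set.mem_smul_set_iff_inv_smul_mem, Set.mem_setOf_eq] at hmem
      refine ⟨hmem.1, ?_⟩
      have hya : Valued.v (h * ((x₀ : K) * Θ x₀) * (ϖE ^ j * (α - ρ α))) = Valued.v ϖE ^ a := by rw [hP.2, v_pow_eq_exp_neg hϖE]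
      have hQ' := (dep_top_iff (Θ := Θ) (α := α) hρρ hvρ hρϖE hϖE hh hm hjl ham hma x₀.ne_zero ((map_ne_zero Θ).2 x₀.ne_zero) hya).1 hQ
      rw [htw] at hQ'; exact hQ'
    · rintro ⟨hω1, hωtop⟩
      have hlevel : Valued.v (1 + ρ h / h * (ρ (((g⁻¹ • x₀ : Kˣ) : K) * Θ ((g⁻¹ • x₀ : Kˣ) : K)) /
          (((g⁻¹ • x₀ : Kˣ) : K) * Θ ((g⁻¹ • x₀ : Kˣ) : K)))) = exp ((a : ℤ) - j) :=
        v_one_add_twist_eq_of_top hvρ hm hjl hdiag he hωtop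
      have hP : x₀ ∈ {x₀ : Kˣ | ((Valued.v (h * ((x₀ : K) * Θ x₀) * (ϖE ^ j * (α - ρ α))) ≤ 1 ∧
              Valued.v (h * ((x₀ : K) * Θ x₀) * (ϖE ^ j * (α - ρ α)) - ρ (h * ((x₀ : K) * Θ x₀) * (ϖE ^ j * (α - ρ α)))) ≤ Valued.v (ϖE ^ j * (α - ρ α))) ∧
            ¬ (Valued.v (h * ((x₀ : K) * Θ x₀) * (ϖE ^ j * (α - ρ α)) / ϖE) ≤ 1 ∧
                Valued.v (h * ((x₀ : K) * Θ x₀) * (ϖE ^ j * (α - ρ α)) / ϖE - ρ (h * ((x₀ : K) * Θ x₀) * (ϖE ^ j * (α - ρ α)) / ϖE)) ≤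
                  Valued.v (ϖE ^ j * (α - ρ α)))) ∧
          Valued.v (h * ((x₀ : K) * Θ x₀) * (ϖE ^ j * (α - ρ α))) = exp (-(a : ℤ))} := by
        rw [hGen, Set.mem_smul_set_iff_inv_smul_mem, Set.mem_setOf_eq]
        exact ⟨hω1, hlevel⟩
      rw [Set.mem_setOf_eq] at hP
      refine ⟨hP, ?_⟩
      have hya : Valued.v (h * ((x₀ : K) * Θ x₀) * (ϖE ^ j * (α - ρ α))) = Valued.v ϖE ^ a := by rw [hP.2, v_pow_eq_exp_neg hϖE]
      refine (dep_top_iff (Θ := Θ) (α := α) hρρ hvρ hρϖE hϖE hh hm hjl ham hma x₀.ne_zero ((map_ne_zero Θ).2 x₀.ne_zero) hya).2 ?_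
      rw [htw]; exact hωtop
  rw [hPQ, ncard_image_mk_smul]
  -- (3) the passing set is a coset `ω₁ • B` or empty
  by_cases hχ : ∃ ω₁ : Kˣ, Valued.v (ω₁ : K) = 1 ∧
        Valued.v (1 + ρ h / h / (ρ μ / μ) * (ρ ((ω₁ : K) * Θ ω₁) / ((ω₁ : K) * Θ ω₁))) ≤ exp (-((j + a : ℕ) - (m : ℤ)))
  · obtain ⟨ω₁, hω₁, hω₁top⟩ := hχ
    rw [if_pos ⟨ω₁, hω₁, hω₁top⟩, setOf_v_one_add_mul_twist_le_eq_smul_of_le hvρ hvΘ hω₁ hω₁top hB, ncard_image_mk_smul_subgroup H B ω₁]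
  · rw [if_neg hχ]
    have hempty : {ω : Kˣ | Valued.v (ω : K) = 1 ∧
        Valued.v (1 + ρ h / h / (ρ μ / μ) * (ρ ((ω : K) * Θ ω) / ((ω : K) * Θ ω))) ≤ exp (-((j + a : ℕ) - (m : ℤ)))} = ∅ :=
      Set.eq_empty_of_forall_notMem (fun ω hω => hχ ⟨ω, hω.1, hω.2⟩)
    rw [hempty, Set.image_empty, Set.ncard_empty]

/-- **THE TOP BIT AS A NORM CLASS** (generic): for units the bit `∃ ω₁, |1 + (ρh∕h)∕(ρμ∕μ)·t(ω₁)| ≤ r` says exactly that `(α − ρα)·h·ρμ ∈ ϖEᶻ · 𝒪_rˣ · N_Θ(U_M)`: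
`∃ v x w, |x| = 1, |w| = 1, |w − ρw| ≤ r, (α − ρα)·h·ρμ = ϖE^v·w·(xΘx)` (`1 + (ρz∕z)·t = (zN + ρ(zN))∕(zN)` for `z = h·ρμ`, and `e(zN + ρ(zN)) = ezN − ρ(ezN)` for the
anti-fixed unit `e = α − ρα`).  This is the sheet's (D3) membership `z ∈ N·𝒪_{c′}ˣ`, with the κ-correct scalar `h·ρμ`. [cite: Jacobowitz1962, §4] [cite: Serre1979, Ch. V §3] -/
theorem top_bit_iff_exists_norm_class (hρρ : ∀ x, ρ (ρ x) = x) (hvΘ : ∀ x, Valued.v (Θ x) = Valued.v x) (hα : Valued.v (α - ρ α) = 1) (hρϖE : ρ ϖE = ϖE) (hϖE : Valued.v ϖE = exp (-1 : ℤ))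
    (hh : h ≠ 0) {μ : K} (hμ : μ ≠ 0) (r : ℤᵐ⁰) :
    (∃ ω₁ : Kˣ, Valued.v (ω₁ : K) = 1 ∧ Valued.v (1 + ρ h / h / (ρ μ / μ) * (ρ ((ω₁ : K) * Θ ω₁) / ((ω₁ : K) * Θ ω₁))) ≤ r) ↔
      ∃ (v : ℤ) (x w : K), Valued.v x = 1 ∧ Valued.v w = 1 ∧ Valued.v (w - ρ w) ≤ r ∧
        (α - ρ α) * h * ρ μ = ϖE ^ v * w * (x * Θ x) := by
  have hϖ0 : ϖE ≠ 0 := (v_varpi_zpow hϖE 0).1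
  have hρμ0 : ρ μ ≠ 0 := (map_ne_zero ρ).2 hμ
  have hρh0 : ρ h ≠ 0 := (map_ne_zero ρ).2 hh
  have he0 : α - ρ α ≠ 0 := fun h0 => by rw [h0, map_zero] at hα; exact zero_ne_one hα
  have hρe : ρ (α - ρ α) = -(α - ρ α) := by rw [map_sub, hρρ, neg_sub]
  obtain ⟨z, hz⟩ : ∃ z : K, z = h * ρ μ := ⟨_, rfl⟩
  have hz0 : z ≠ 0 := by rw [hz]; exact mul_ne_zero hh hρμ0
  have hρz : ρ z = ρ h * μ := by rw [hz, map_mul, hρρ]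
  -- the twist coefficient is `ρz∕z`
  have hη : ρ h / h / (ρ μ / μ) = ρ z / z := by rw [hρz, hz]; field_simp
  -- key identity: for a unit norm `N`, `1 + (ρz∕z)(ρN∕N) = (zN + ρ(zN))∕(zN)` and `|e(zN + ρ(zN))| = |ezN − ρ(ezN)|`
  have hkey : ∀ N : K, N ≠ 0 → 1 + ρ z / z * (ρ N / N) = (z * N + ρ (z * N)) / (z * N) := fun N hN => by
    rw [map_mul]; field_simp
  have hanti : ∀ y : K, (α - ρ α) * y - ρ ((α - ρ α) * y) = (α - ρ α) * (y + ρ y) := fun y => by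
    rw [map_mul, hρe]; ring
  constructor
  · rintro ⟨ω₁, hω₁, hle⟩
    have hN0 : (ω₁ : K) * Θ ω₁ ≠ 0 := mul_ne_zero ω₁.ne_zero ((map_ne_zero Θ).2 ω₁.ne_zero)
    have hN1 : Valued.v ((ω₁ : K) * Θ ω₁) = 1 := by rw [map_mul, hvΘ, hω₁, mul_one]
    rw [hη, hkey _ hN0, map_div₀, div_le_iff₀ ((Valuation.pos_iff _).2 (mul_ne_zero hz0 hN0))] at hle
    -- `y := e·z·N`, decomposed as `ϖE^v · y₀`
    have hy0 : (α - ρ α) * (z * ((ω₁ : K) * Θ ω₁)) ≠ 0 := mul_ne_zero he0 (mul_ne_zero hz0 hN0)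
    obtain ⟨v, y₀, hy₀, hyeq⟩ := exists_eq_varpi_zpow_mul_unit hϖE hy0
    have hvy : Valued.v ((α - ρ α) * (z * ((ω₁ : K) * Θ ω₁))) = Valued.v (ϖE ^ v) := by rw [hyeq, map_mul, hy₀, mul_one]
    refine ⟨v, ((ω₁⁻¹ : Kˣ) : K), y₀, by rw [Units.val_inv_eq_inv_val, map_inv₀, hω₁, inv_one], hy₀, ?_, ?_⟩
    · -- `|y₀ − ρy₀|·|ϖE^v| = |y − ρy| = |e|·|zN + ρ(zN)| ≤ |ϖE^v|·r`
      have h1 : Valued.v ((α - ρ α) * (z * ((ω₁ : K) * Θ ω₁)) - ρ ((α - ρ α) * (z * ((ω₁ : K) * Θ ω₁)))) ≤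
          r * Valued.v (z * ((ω₁ : K) * Θ ω₁)) := by
        rw [hanti, map_mul, hα, one_mul]; exact hle
      rw [hyeq, map_mul, map_zpow₀, hρϖE, ← mul_sub, map_mul] at h1
      have h2 : Valued.v (z * ((ω₁ : K) * Θ ω₁)) = Valued.v (ϖE ^ v) := by
        rw [← hvy, map_mul Valued.v (α - ρ α) (z * ((ω₁ : K) * Θ ω₁)), hα, one_mul]
      rw [h2, mul_comm r] at h1
      exact le_of_mul_le_mul_left h1 ((Valuation.pos_iff _).2 (zpow_ne_zero v hϖ0))
    · -- `e·h·ρμ = ϖE^v·y₀·N⁻¹`, `N⁻¹ = ω₁⁻¹·Θω₁⁻¹`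
      rw [Units.val_inv_eq_inv_val, map_inv₀]
      have : (α - ρ α) * h * ρ μ * ((ω₁ : K) * Θ ω₁) = ϖE ^ v * y₀ := by rw [← hyeq, hz]; ring
      field_simp
      linear_combination this
  · rintro ⟨v, x, w, hx, hw, hwr, heq⟩
    have hx0 : x ≠ 0 := fun h0 => by rw [h0, map_zero] at hx; exact zero_ne_one hx
    have hΘx0 : Θ x ≠ 0 := (map_ne_zero Θ).2 hx0
    refine ⟨(Units.mk0 x hx0)⁻¹, by rw [Units.val_inv_eq_inv_val, Units.val_mk0, map_inv₀, hx, inv_one], ?_⟩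
    have hN0 : (((Units.mk0 x hx0)⁻¹ : Kˣ) : K) * Θ (((Units.mk0 x hx0)⁻¹ : Kˣ) : K) ≠ 0 :=
      mul_ne_zero (Units.ne_zero _) ((map_ne_zero Θ).2 (Units.ne_zero _))
    rw [hη, hkey _ hN0, map_div₀, div_le_iff₀ ((Valuation.pos_iff _).2 (mul_ne_zero hz0 hN0))]
    -- `zN = ϖE^v·w∕e`
    have hzN : z * ((((Units.mk0 x hx0)⁻¹ : Kˣ) : K) * Θ (((Units.mk0 x hx0)⁻¹ : Kˣ) : K)) = ϖE ^ v * w / (α - ρ α) := by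
      rw [Units.val_inv_eq_inv_val, Units.val_mk0, map_inv₀, hz, eq_div_iff he0]
      have : (α - ρ α) * h * ρ μ = ϖE ^ v * w * (x * Θ x) := heq
      field_simp
      linear_combination this
    rw [hzN, map_div₀, map_mul, map_zpow₀, hρϖE, hρe, div_neg, ← sub_eq_add_neg, ← sub_div, ← mul_sub, map_div₀, map_div₀,
      map_mul, map_mul, hα, div_one, div_one, hw, mul_one, mul_comm r]
    exact mul_le_mul' le_rfl hwr

/-! ## §2 The type-RamK index form: `#levelSetDep·idxRK(s₀) = |G_j|·bit` -/

open scoped Classical in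
open Literature.NumberTheory.Automorphic.UnitaryThreeFourFrame in
/-- **(D3) TOP COUNT, TYPE RamK, INDEX FORM**: in the two-field RamK frame (★ p857459's binders; `Θh = h`, so `v(h)` is even and the parity gate is `j ≡ a (2)`), on the top half
of the diagonal with `1 ≤ a ≤ j`, `j ≥ 1`: `#levelSetDep(j,a;μ) · idxRK(q,d,j+a−m) = (q+1)q^(j−1) · bit`. [cite: Flicker1998UnitaryFL, Prop. 7 p. 84] [cite: Jacobowitz1962, §4]
[cite: Serre1979, Ch. V §3] -/
theorem ncard_levelSetDep_top_mul_eq_of_ramK [CompleteSpace K] [IsDiscreteValuationRing 𝒪[K]] [Finite 𝓀[K]]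
    [CompleteSpace K'] [IsDiscreteValuationRing 𝒪[K']] [Finite 𝓀[K']]
    (hρρ : ∀ x, ρ (ρ x) = x) (hvρ : ∀ x, Valued.v (ρ x) = Valued.v x) (hΘρ : ∀ x, Θ (ρ x) = ρ (Θ x))
    (hα1 : Valued.v α ≤ 1) (hα : Valued.v (α - ρ α) = 1) {d t : ℕ} (hD : IsRamifiedQuadraticDatum Θ ϖE d t) (hρϖ : ρ ϖE = ϖE)
    (hΘh : Θ h = h) (hh : h ≠ 0) {q : ℕ} (hq : Nat.card 𝓀[K] = q ^ 2)
    (hσ' : ∀ x, σ' (σ' x) = x) (hvσ' : ∀ x, Valued.v (σ' x) = Valued.v x) (hα'1 : Valued.v α' ≤ 1) (hα' : Valued.v (α' - σ' α') = 1)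
    (hπ' : Valued.v π' = exp (-1 : ℤ)) (hq' : Nat.card 𝓀[K'] = q ^ 2)
    (jK : K' →+* K) (hjv : ∀ x, Valued.v (jK x) = Valued.v x ^ 2) (hjΘ : ∀ x, Θ (jK x) = jK x) (hjfix : ∀ z : K, Θ z = z → ∃ x, jK x = z)
    (hjσ : ∀ x, jK (σ' x) = ρ (jK x))
    {μ : K} {m jl : ℕ} (hm : Valued.v μ = exp (-(m : ℤ))) (hjl : Valued.v (μ - ρ μ) = exp (-(jl : ℤ)))
    {j a : ℕ} (ha : 1 ≤ a) (haj : a ≤ j) (ham : a ≤ m) (hdiag : j + m = jl + a) (htop : m + 1 ≤ 2 * a) (hpar : (j + a) % 2 = 0) :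
    (levelSetDep ρ Θ α ϖE h j a μ).ncard *
        (if j + a - m = 0 then 1 else if j + a - m + 2 ≤ 2 * d then (q + 1) * q ^ ((j + a - m + 1) / 2 - 1)
          else (q + 1) * q ^ ((j + a - m + 1) / 2 - 1) / 2) =
      if ∃ ω₁ : Kˣ, Valued.v (ω₁ : K) = 1 ∧
        Valued.v (1 + ρ h / h / (ρ μ / μ) * (ρ ((ω₁ : K) * Θ ω₁) / ((ω₁ : K) * Θ ω₁))) ≤ exp (-((j + a : ℕ) - (m : ℤ)))
      then (q + 1) * q ^ (j - 1) else 0 := by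
  classical
  have hΘΘ : ∀ x, Θ (Θ x) = x := hD.1
  have hvΘ : ∀ x, Valued.v (Θ x) = Valued.v x := hD.2.1
  have hϖE : Valued.v ϖE = exp (-1 : ℤ) := hD.2.2.1
  -- parity: `v(h) = exp(−2k)`
  obtain ⟨s', hs'⟩ := hjfix h hΘh
  have hs'0 : s' ≠ 0 := by rintro rfl; rw [map_zero] at hs'; exact hh hs'.symm
  obtain ⟨k, u', hu', hs'eq⟩ := exists_eq_varpi_zpow_mul_unit hπ' hs'0
  have hvh : Valued.v h = exp (-(2 * k)) := by
    rw [← hs', hjv, hs'eq, map_mul, hu', mul_one, (v_varpi_zpow hπ' k).2, sq, ← exp_add]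
    congr 1; ring
  -- subgroups and indices
  obtain ⟨U, hU⟩ := Literature.NumberTheory.LocalFields.WildQuadraticDatum.exists_subgroup_v_eq_one (K := K)
  obtain ⟨H, hH⟩ := exists_subgroup_orderUnits (ρ := ρ) (α := α) hvρ (ϖE ^ j)
  obtain ⟨Ut, hUt⟩ := exists_subgroup_thetaFixed_units (K := K) (Θ := Θ)
  obtain ⟨B, hB⟩ := exists_subgroup_normDepth (Θ := Θ) hvρ hvΘ (exp (-((j + a - m : ℕ) : ℤ)))
  obtain ⟨Vt, hVt⟩ := exists_subgroup_thetaFixed_depth (K := K) (Θ := Θ) hvρ (exp (-((j + a - m : ℕ) : ℤ)))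
  have hvc : Valued.v (ϖE ^ j * (α - ρ α)) = exp (-(j : ℤ)) := by
    rw [map_mul, hα, mul_one, map_pow, hϖE, ← exp_nsmul, nsmul_eq_mul, mul_neg, mul_one]
  have hs : (-((j + a : ℕ) - (m : ℤ))) = -((j + a - m : ℕ) : ℤ) := by push_cast; omega
  have hB' : ∀ ω : Kˣ, ω ∈ B ↔ Valued.v (ω : K) = 1 ∧ Valued.v ((ω : K) * Θ ω - ρ ((ω : K) * Θ ω)) ≤ exp (-((j + a : ℕ) - (m : ℤ))) :=
    fun ω => by rw [hB ω, hs]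
  have hBU : B.relIndex U = if j + a - m = 0 then 1 else if j + a - m + 2 ≤ 2 * d then (q + 1) * q ^ ((j + a - m + 1) / 2 - 1)
      else (q + 1) * q ^ ((j + a - m + 1) / 2 - 1) / 2 :=
    relIndex_normDepth_eq_of_ramK hρρ hvρ hα1 hα hΘρ hD hρϖ hσ' hvσ' hα'1 hα' hπ' hq' jK hjv hjΘ hjfix hjσ (j + a - m) U Ut Vt B hU hUt hVt hB
  have hBle : B ≤ U := fun ω hω => (hU ω).2 ((hB ω).1 hω).1
  have hHB : H ≤ B := orderUnits_le_normDepth hvρ hΘρ hvΘ (by rw [hvc, exp_le_exp]; omega) hH hB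
  have hHU : H.relIndex U = (q + 1) * q ^ (j - 1) := by
    have hH' : ∀ u, u ∈ H ↔ Valued.v (u : K) = 1 ∧ Valued.v ((u : K) - ρ u) ≤ Valued.v (ϖE ^ j) := fun u => by
      rw [hH u, map_mul Valued.v (ϖE ^ j), hα, mul_one]
    exact relIndex_orderUnits_eq_of_unramified hρρ hvρ hα1 hα hϖE hq (by omega) U H hU hH'
  have hmul := Subgroup.relIndex_mul_relIndex H B U hHB hBle
  rw [ncard_levelSetDep_top_eq_ite hρρ hvρ hΘΘ hΘρ hvΘ hα1 hα hρϖ hϖE hh hvh hm hjl ha haj ham hdiag htop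
    (k₀ := -k + (((j + a) / 2 : ℕ) : ℤ) - j) (by push_cast; omega) H B hH hB', ← hBU]
  split_ifs
  · rw [hmul, hHU]
  · rw [zero_mul]

end Summit.HodgeConjecture.HodgeConjecture.Cruxes.H413.F0P3cDyRamToricLevelCensusRamK
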